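import Summits.HodgeConjecture.HodgeConjecture.Theorems.Ring2WeilCoverageCMFieldDegreeOneCriteria
import Summits.HodgeConjecture.HodgeConjecture.Theorems.Ring2WeilCoverageCMFieldInertPrimes
import Summits.HodgeConjecture.HodgeConjecture.Theorems.Ring2WeilCoverageCMFieldSquareClasses
import HarnessLib

/-!
# Non-split Weil-type components over the NON-GALOIS quartic CM field `E = ℚ(√-(3+√2))` (`D₄`, class number 2):
# the classes obstructed at the RAMIFIED degree-one place `(3+√2)` and at the HALF-SPLIT prime `23`

research route conditional on HC_CM; not a corollary; Q11.4-sentence-2 already refuted in dim ≥ 3.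
Cell `pub-hodge-ring2`, seat `ring2-b03` (gen 48); kernel certificates for the Weil-type family-coverage census
`HOME/WEIL-FAMILY-COVERAGE.md` §b03.5, table of `E = ℚ(√-(3+√2)) = ℚ[T]/(T⁴ + 6T² + 7)`, `F = ℚ(√2) = ℚ[S]/(S² + 6S + 7)`
(`σ = η² = -(3+√2)`, `Nm_{F/ℚ} σ = 7`; Deligne's carriers `Deligne1982/WeilTypeCMDiscriminant`). Gens 46–47 decided
the `13` classes `[n]`, `n ≤ 40`, obstructed at a prime INERT in `F` (`ℓ = 5, 11, 13`,
`Ring2WeilCoverageCMFieldInertPrimes` §5); the remaining `14` non-split classes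
`n ∈ {3, 6, 7, 12, 14, 17, 19, 23, 24, 27, 28, 31, 34, 38}` are obstructed only at the wild place `(√2)`, at the
tame place `𝔭₇' = (3 + √2) = (σ)` — RAMIFIED in `E = F(√σ)`, of degree one over `7`, which SPLITS in `F`, so that
`R` is not Eisenstein — or at a «half-split» prime (`17 = 𝔭𝔭̄`, `23 = 𝔭𝔭̄` with `𝔭` inert and `𝔭̄` split in
`E/F`: `E/ℚ` is not Galois). They are decided here by the degree-one descents of
`Ring2WeilCoverageCMFieldDegreeOne{Primes,Criteria}` (same gen):

* §1 at `(σ)` (`q = 7` prime): `[n] ≠ [1]` for every `n ≡ 3, 5, 6 (mod 7)` (the non-squares; census classes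
  `[3]`, `[6]`, `[12]`, `[17]`, `[19]`, `[24]`, `[27]`, `[31]`, `[34]`, `[38]`) and `[7w] ≠ [1]` for `w ≡ 1, 2, 4 (mod 7)`
  (`6w` a non-square; classes `[7]`, `[14]`, `[28]`; NB `[21] = [1]`);
* §2 at `π = 8 + σ = 5 - √2` (`Nm π = 23`, `σ ≡ -8 ≡ 15` a non-square mod `23`: `(π)` inert in `E/F`, while the
  conjugate `(5 + √2)` splits): `[23w] ≠ [1]` for `23 ∤ w` (class `[23]`, `T = {(√2), (23, √2-5)}`);
* §3 literal packagings (`R = S² + 6S + 7` verbatim, the `Fact` from factor exclusion);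
* §4 the positive companion: a value `a² - σb²` of the norm form IS a norm (`mem_normUnitsSubgroup_of_eq_normForm`,
  generic), `[u₁] = [u₂]` from `u₁u₂ ∈ Nm` (exponent 2), and the instances **`[3 - √2] = [3]`**
  (`3(3 - √2) = Nm_{E/F}(2 - √2 + η)`), **`[2 + √2] = [3]`** (`3(2+√2) = Nm_{E/F}(1 + √2 + η)`; least `δ` vs least `n`): the discriminant of the census's explicit unimodular hermitian lattice
  `O_E³ ⊕ 𝔔⁻¹`, `⟨1,1,-1,-(3-√2)⟩` ((F3) witness on the `D₄` field, §b03.13) lies on the non-split row `n = 3`.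

With this file EVERY non-split class `n ≤ 40` of all SEVEN tables of §b03.5 is decided in the kernel (`27/27` for
the `D₄` field). No named fact, no definition, no `sorry`; nothing about the Hodge conjecture is asserted: the
theorems say which components `W8.E.δ` are non-split (no `E`-Lagrangian member, Deligne Cor. 4.2).
References: [Deligne1982HodgeCycles] §4 p. 30 (1), Cor. 4.2, Lemma 4.6; [Landherr1936HermitianForms]. -/

noncomputable section

set_option linter.dupNamespace false

open Polynomial

namespace Summit.HodgeConjecture.HodgeConjecture.Ring2.WeilCoverageCM

open Literature.AlgebraicGeometry.Deligne1982
open Literature.AlgebraicGeometry.HodgeTheory (splitDiscriminantClassCM)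

/-! ### §1 The ramified degree-one place `(σ) = (3+√2)` over `7` -/

/-- **`[n] ≠ [1]` for `E = ℚ(√-(3+√2))`, `F = ℚ(√2)`, every rational integer `n` that is a NON-SQUARE mod `7`**
(`(n, σ)_{(σ)} = -1` at the tame ramified place `(σ)` of norm `7`): census classes `[3]`, `[6]`, `[12]`, `[17]`,
`[19]`, `[24]`, `[27]`, `[31]`, `[34]`, `[38]` of the `D₄` table are NON-SPLIT. [cite: Deligne1982HodgeCycles, §4 p. 30 (1) and Cor. 4.2]
[cite: Landherr1936HermitianForms] -/
theorem sqrtNegThreePlusSqrtTwo_mk_ne_splitDiscriminantClassCM_of_nonsq_mod_seven {R : Polynomial ℤ}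
    (hR : R = X ^ 2 + C 6 * X + C 7) [Fact (Irreducible (realPolyQ R))] (n : ℤ)
    (hn : ∀ s : ZMod 7, s ^ 2 ≠ (n : ZMod 7))
    (u : (realField R)ˣ) (hu : (u : realField R) = AdjoinRoot.of (realPolyQ R) n) :
    (QuotientGroup.mk u : cmNormResidueGroup R) ≠ splitDiscriminantClassCM R 2 :=
  mk_ne_splitDiscriminantClassCM_of_ramified_nonsq hR (by norm_num) (by norm_num) disc_not_sq_six_seven
    7 (by norm_num) rfl n hn u hu

/-- **`[n] ≠ [1]` for `E = ℚ(√-(3+√2))`, `n ≡ 3, 5, 6 (mod 7)`** (the three non-squares mod `7`) — residue form of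
the preceding theorem; e.g. `n = 3, 6, 12, 17, 19, 24, 27, 31, 34, 38`. [cite: Deligne1982HodgeCycles, §4 p. 30 (1) and Cor. 4.2] -/
theorem sqrtNegThreePlusSqrtTwo_mk_ne_splitDiscriminantClassCM_of_residue {R : Polynomial ℤ}
    (hR : R = X ^ 2 + C 6 * X + C 7) [Fact (Irreducible (realPolyQ R))] (n : ℤ)
    (hres : (n : ZMod 7) = 3 ∨ (n : ZMod 7) = 5 ∨ (n : ZMod 7) = 6)
    (u : (realField R)ˣ) (hu : (u : realField R) = AdjoinRoot.of (realPolyQ R) n) :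
    (QuotientGroup.mk u : cmNormResidueGroup R) ≠ splitDiscriminantClassCM R 2 := by
  have key : ∀ s : ZMod 7, s ^ 2 ≠ 3 ∧ s ^ 2 ≠ 5 ∧ s ^ 2 ≠ 6 := by decide
  refine sqrtNegThreePlusSqrtTwo_mk_ne_splitDiscriminantClassCM_of_nonsq_mod_seven hR n (fun s hs => ?_) u hu
  rcases hres with h | h | h
  · exact (key s).1 (hs.trans h)
  · exact (key s).2.1 (hs.trans h)
  · exact (key s).2.2 (hs.trans h)

/-- **`[7w] ≠ [1]` for `E = ℚ(√-(3+√2))`, `w ≡ 1, 2, 4 (mod 7)`** (the squares: then `-σ̄ w ≡ 6w (mod σ)` is a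
non-square): census classes `[7]`, `[14]`, `[28]` are NON-SPLIT (whereas `21 = 7·3` IS a norm, `[21] = [1]`).
[cite: Deligne1982HodgeCycles, §4 p. 30 (1) and Cor. 4.2] [cite: Landherr1936HermitianForms] -/
theorem sqrtNegThreePlusSqrtTwo_mk_seven_mul_ne_splitDiscriminantClassCM {R : Polynomial ℤ}
    (hR : R = X ^ 2 + C 6 * X + C 7) [Fact (Irreducible (realPolyQ R))] (w : ℤ)
    (hw : (w : ZMod 7) = 1 ∨ (w : ZMod 7) = 2 ∨ (w : ZMod 7) = 4)
    (u : (realField R)ˣ) (hu : (u : realField R) = AdjoinRoot.of (realPolyQ R) (7 * w)) :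
    (QuotientGroup.mk u : cmNormResidueGroup R) ≠ splitDiscriminantClassCM R 2 := by
  have key : ∀ s : ZMod 7, s ^ 2 ≠ ((6 : ℤ) : ZMod 7) * 1 ∧ s ^ 2 ≠ ((6 : ℤ) : ZMod 7) * 2 ∧
      s ^ 2 ≠ ((6 : ℤ) : ZMod 7) * 4 := by decide
  refine mk_prime_mul_ne_splitDiscriminantClassCM_of_ramified hR (by norm_num) (by norm_num) disc_not_sq_six_seven
    7 (by norm_num) rfl w (fun s hs => ?_) u hu
  rcases hw with h | h | h
  · exact (key s).1 (by rw [hs, h])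
  · exact (key s).2.1 (by rw [hs, h])
  · exact (key s).2.2 (by rw [hs, h])

/-! ### §2 The half-split prime `23`: `π = 8 + σ = 5 - √2`, `(π)` inert in `E/F`, `(π̄)` split -/

/-- **`[23w] ≠ [1]` for `E = ℚ(√-(3+√2))`, `23 ∤ w`**: `π = 8 + σ` has `Nm π = 8² - 6·8 + 7 = 23`, `σ ≡ -8` is a
non-square mod `23` (the place `(π) = (23, √2 - 5)` is INERT in `E/F`; its conjugate `(23, √2 + 5)` splits — the
field is not Galois over `ℚ`), `2·8 - 6 = 10 ≢ 0`: census class `[23]` (`T = {(√2), (23, √2-5)}`) is NON-SPLIT.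
[cite: Deligne1982HodgeCycles, §4 p. 30 (1) and Cor. 4.2] [cite: Landherr1936HermitianForms] -/
theorem sqrtNegThreePlusSqrtTwo_mk_twentyThree_mul_ne_splitDiscriminantClassCM {R : Polynomial ℤ}
    (hR : R = X ^ 2 + C 6 * X + C 7) [Fact (Irreducible (realPolyQ R))] (w : ℤ) (hw : ¬ (23 : ℤ) ∣ w)
    (u : (realField R)ˣ) (hu : (u : realField R) = AdjoinRoot.of (realPolyQ R) (23 * w)) :
    (QuotientGroup.mk u : cmNormResidueGroup R) ≠ splitDiscriminantClassCM R 2 :=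
  mk_prime_mul_ne_splitDiscriminantClassCM_of_inert_degreeOne hR (by norm_num) (by norm_num) disc_not_sq_six_seven
    8 23 (by norm_num) (by norm_num) (by decide) (by decide) w hw u hu

/-! ### §3 Literal packagings (`R = S² + 6S + 7` verbatim; the `Fact` from factor exclusion) -/

/-- **`[3] ≠ [1]` for `ℚ(√-(3+√2))`**: the FIRST non-split row of the `D₄` table (least representative `3` of the
class `T = {(√2), (7, √2+3)}` = `[2+√2]`; also the only candidate row besides `[1]` for an `O_E`-linear principally
polarised member, §b03.7). [cite: Deligne1982HodgeCycles, §4 p. 30 (1) and Cor. 4.2] -/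
theorem sqrtNegThreePlusSqrtTwo_three_nonsplit :
    haveI := fact_irreducible_realPolyQ_of_not_sq (R := X ^ 2 + C 6 * X + C 7) rfl disc_not_sq_six_seven
    ∀ u : (realField (X ^ 2 + C 6 * X + C 7))ˣ, (u : realField (X ^ 2 + C 6 * X + C 7)) = 3 →
      (QuotientGroup.mk u : cmNormResidueGroup (X ^ 2 + C 6 * X + C 7)) ≠
        splitDiscriminantClassCM (X ^ 2 + C 6 * X + C 7) 2 := by
  haveI := fact_irreducible_realPolyQ_of_not_sq (R := X ^ 2 + C 6 * X + C 7) rfl disc_not_sq_six_seven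
  exact fun u hu => sqrtNegThreePlusSqrtTwo_mk_ne_splitDiscriminantClassCM_of_residue rfl 3 (Or.inl rfl) u
    (by rw [hu]; simp)

/-- **`[7] ≠ [1]` for `ℚ(√-(3+√2))`**: `7 = Nm_{F/ℚ}(3+√2)` is not a norm from `E` (class `T = {(√2), (7, √2+3)}`).
[cite: Deligne1982HodgeCycles, §4 p. 30 (1) and Cor. 4.2] -/
theorem sqrtNegThreePlusSqrtTwo_seven_nonsplit :
    haveI := fact_irreducible_realPolyQ_of_not_sq (R := X ^ 2 + C 6 * X + C 7) rfl disc_not_sq_six_seven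
    ∀ u : (realField (X ^ 2 + C 6 * X + C 7))ˣ, (u : realField (X ^ 2 + C 6 * X + C 7)) = 7 →
      (QuotientGroup.mk u : cmNormResidueGroup (X ^ 2 + C 6 * X + C 7)) ≠
        splitDiscriminantClassCM (X ^ 2 + C 6 * X + C 7) 2 := by
  haveI := fact_irreducible_realPolyQ_of_not_sq (R := X ^ 2 + C 6 * X + C 7) rfl disc_not_sq_six_seven
  exact fun u hu => sqrtNegThreePlusSqrtTwo_mk_seven_mul_ne_splitDiscriminantClassCM rfl 1 (Or.inl rfl) u
    (by rw [hu]; simp)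

/-- **`[17] ≠ [1]` for `ℚ(√-(3+√2))`**: although `T(17) = {(7, √2+3), (17, √2+6)}` consists of a ramified and a
HALF-SPLIT place only, the class is decided at `(7, √2+3)` (`17 ≡ 3` is a non-square mod `7`).
[cite: Deligne1982HodgeCycles, §4 p. 30 (1) and Cor. 4.2] -/
theorem sqrtNegThreePlusSqrtTwo_seventeen_nonsplit :
    haveI := fact_irreducible_realPolyQ_of_not_sq (R := X ^ 2 + C 6 * X + C 7) rfl disc_not_sq_six_seven
    ∀ u : (realField (X ^ 2 + C 6 * X + C 7))ˣ, (u : realField (X ^ 2 + C 6 * X + C 7)) = 17 →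
      (QuotientGroup.mk u : cmNormResidueGroup (X ^ 2 + C 6 * X + C 7)) ≠
        splitDiscriminantClassCM (X ^ 2 + C 6 * X + C 7) 2 := by
  haveI := fact_irreducible_realPolyQ_of_not_sq (R := X ^ 2 + C 6 * X + C 7) rfl disc_not_sq_six_seven
  exact fun u hu => sqrtNegThreePlusSqrtTwo_mk_ne_splitDiscriminantClassCM_of_residue rfl 17 (Or.inl (by decide)) u
    (by rw [hu]; simp)

/-- **`[23] ≠ [1]` for `ℚ(√-(3+√2))`**: the class obstructed at the dyadic place and at ONE of the two places over
`23` only — decided at the half-split prime. [cite: Deligne1982HodgeCycles, §4 p. 30 (1) and Cor. 4.2] -/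
theorem sqrtNegThreePlusSqrtTwo_twentyThree_nonsplit :
    haveI := fact_irreducible_realPolyQ_of_not_sq (R := X ^ 2 + C 6 * X + C 7) rfl disc_not_sq_six_seven
    ∀ u : (realField (X ^ 2 + C 6 * X + C 7))ˣ, (u : realField (X ^ 2 + C 6 * X + C 7)) = 23 →
      (QuotientGroup.mk u : cmNormResidueGroup (X ^ 2 + C 6 * X + C 7)) ≠
        splitDiscriminantClassCM (X ^ 2 + C 6 * X + C 7) 2 := by
  haveI := fact_irreducible_realPolyQ_of_not_sq (R := X ^ 2 + C 6 * X + C 7) rfl disc_not_sq_six_seven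
  exact fun u hu => sqrtNegThreePlusSqrtTwo_mk_twentyThree_mul_ne_splitDiscriminantClassCM rfl 1 (by norm_num) u
    (by rw [hu]; simp)

/-! ### §4 The discriminant `3 - √2 = 6 + σ` of the (F3) witness lies on the row `[3]` -/

section NormMembership

variable {R : Polynomial ℤ} [Fact (Irreducible (realPolyQ R))] [Fact (Irreducible (cmPolyQ R))]

/-- **A value of the norm form is a norm**: if `u = a² - σb²` (`a, b ∈ F`), then `u ∈ Nm_{E/F}(E^×)` — witnessed by
`z = a + bη` (`Nm_{E/F} z = z z̄ = a² - σb²`, `Deligne1982.algebraMap_norm_eq_mul_cmConj`). The positive companion of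
the non-split certificates. [cite: Deligne1982HodgeCycles, §4 p. 30] -/
theorem mem_normUnitsSubgroup_of_eq_normForm (u : (realField R)ˣ) (a b : realField R)
    (hu : (u : realField R) = a ^ 2 - AdjoinRoot.root (realPolyQ R) * b ^ 2) :
    u ∈ Literature.AlgebraicGeometry.Motives.normUnitsSubgroup (realField R) (cmField R) := by
  set z : cmField R := realToCM R a + realToCM R b * cmRoot R with hz
  have hnorm : Algebra.norm (realField R) z = (u : realField R) := by
    apply (realToCM R).injective
    rw [← algebraMap_realField_eq, algebraMap_norm_eq_mul_cmConj, algebraMap_realField_eq, hz, norm_coords, hu]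
  have hz0 : z ≠ 0 := by
    intro h0
    apply u.ne_zero
    rw [← hnorm, h0, Algebra.norm_zero]
  exact Literature.AlgebraicGeometry.Motives.mem_normUnitsSubgroup_iff.2 ⟨Units.mk0 z hz0, by rw [Units.val_mk0, hnorm]⟩

/-- **Equality of classes from one norm**: `u₁·u₂ ∈ Nm(E^×) ⇒ [u₁] = [u₂]` in `F^×/Nm_{E/F}(E^×)` (the group has
exponent `2`: `u₁⁻¹u₂ = (u₁u₂)·(u₁⁻¹)²`). [cite: Deligne1982HodgeCycles, §4 p. 30] -/
theorem mk_eq_mk_of_mul_mem_normUnitsSubgroup (u₁ u₂ : (realField R)ˣ)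
    (h : u₁ * u₂ ∈ Literature.AlgebraicGeometry.Motives.normUnitsSubgroup (realField R) (cmField R)) :
    (QuotientGroup.mk u₁ : cmNormResidueGroup R) = QuotientGroup.mk u₂ := by
  have e : (u₁ * u₂) * (u₁ ^ 2)⁻¹ = u₁⁻¹ * u₂ := by
    rw [sq, mul_inv_rev, mul_comm u₁ u₂, mul_assoc, mul_inv_cancel_left, mul_comm]
  rw [QuotientGroup.eq, ← e]
  exact mul_mem h (inv_mem (sq_mem_normUnitsSubgroup_cmField _))

end NormMembership

/-- **`[3 - √2] = [3]` for `E = ℚ(√-(3+√2))`** (`3 - √2 = 6 + σ`): `3·(3 - √2) = 9 - 3√2 = (2-√2)² + (3+√2)·1²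
= Nm_{E/F}(2 - √2 + η)` (`2 - √2 = 5 + σ`). CENSUS USE (§b03.13, (F3) on the `D₄` field): the explicit UNIMODULAR
hermitian `O_E`-lattice `O_E³ ⊕ 𝔔⁻¹`, `φ' = ⟨1, 1, -1, -(3-√2)⟩` (`𝔔 ∣ (3-√2)`), of signature (2,2)², has
discriminant `3 - √2`; this theorem places it on the census row `n = 3` (`T = {(√2), (7,√2+3)}` = `[2+√2]`),
which is non-split by `sqrtNegThreePlusSqrtTwo_three_nonsplit`. [cite: Deligne1982HodgeCycles, §4 p. 30 (1) and Cor. 4.2] -/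
theorem sqrtNegThreePlusSqrtTwo_mk_threeSubSqrtTwo_eq_mk_three {R : Polynomial ℤ}
    (hR : R = X ^ 2 + C 6 * X + C 7) [Fact (Irreducible (realPolyQ R))] (u₁ u₂ : (realField R)ˣ)
    (hu₁ : (u₁ : realField R) = 6 + AdjoinRoot.root (realPolyQ R)) (hu₂ : (u₂ : realField R) = 3) :
    (QuotientGroup.mk u₁ : cmNormResidueGroup R) = QuotientGroup.mk u₂ := by
  haveI : Fact (Irreducible (cmPolyQ R)) :=
    fact_irreducible_cmPolyQ_of_pos hR (by norm_num) (by norm_num) disc_not_sq_six_seven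
  have hσ := root_rel_quadratic hR
  push_cast at hσ
  refine mk_eq_mk_of_mul_mem_normUnitsSubgroup u₁ u₂
    (mem_normUnitsSubgroup_of_eq_normForm _ (5 + AdjoinRoot.root (realPolyQ R)) 1 ?_)
  rw [Units.val_mul, hu₁, hu₂]
  linear_combination (-1 : realField R) * hσ

/-- **`[2 + √2] = [3]` for `E = ℚ(√-(3+√2))`** (`2 + √2 = -1 - σ`, the census's least totally positive
representative of the row `T = {(√2), (7,√2+3)}`): `3·(2 + √2) = 6 + 3√2 = (1+√2)² + (3+√2)·1² = Nm_{E/F}(1 + √2 + η)`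
(`1 + √2 = -2 - σ`). Kernel link between the two labels `δ = 2+√2` / `n = 3` of that census row. [cite: Deligne1982HodgeCycles, §4 p. 30 (1) and Cor. 4.2] -/
theorem sqrtNegThreePlusSqrtTwo_mk_twoAddSqrtTwo_eq_mk_three {R : Polynomial ℤ}
    (hR : R = X ^ 2 + C 6 * X + C 7) [Fact (Irreducible (realPolyQ R))] (u₁ u₂ : (realField R)ˣ)
    (hu₁ : (u₁ : realField R) = -1 - AdjoinRoot.root (realPolyQ R)) (hu₂ : (u₂ : realField R) = 3) :
    (QuotientGroup.mk u₁ : cmNormResidueGroup R) = QuotientGroup.mk u₂ := by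
  haveI : Fact (Irreducible (cmPolyQ R)) :=
    fact_irreducible_cmPolyQ_of_pos hR (by norm_num) (by norm_num) disc_not_sq_six_seven
  have hσ := root_rel_quadratic hR
  push_cast at hσ
  refine mk_eq_mk_of_mul_mem_normUnitsSubgroup u₁ u₂
    (mem_normUnitsSubgroup_of_eq_normForm _ (-2 - AdjoinRoot.root (realPolyQ R)) 1 ?_)
  rw [Units.val_mul, hu₁, hu₂]
  linear_combination (-1 : realField R) * hσ

/-- **`[3 - √2] ≠ [1]`**: the (F3) witness row of `ℚ(√-(3+√2))` is the NON-SPLIT row `[3] = [2+√2]` (with `R`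
LITERALLY `S² + 6S + 7`). [cite: Deligne1982HodgeCycles, §4 p. 30 (1) and Cor. 4.2] -/
theorem sqrtNegThreePlusSqrtTwo_threeSubSqrtTwo_nonsplit :
    haveI := fact_irreducible_realPolyQ_of_not_sq (R := X ^ 2 + C 6 * X + C 7) rfl disc_not_sq_six_seven
    ∀ u : (realField (X ^ 2 + C 6 * X + C 7))ˣ,
      (u : realField (X ^ 2 + C 6 * X + C 7)) = 6 + AdjoinRoot.root (realPolyQ (X ^ 2 + C 6 * X + C 7)) →
      (QuotientGroup.mk u : cmNormResidueGroup (X ^ 2 + C 6 * X + C 7)) ≠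
        splitDiscriminantClassCM (X ^ 2 + C 6 * X + C 7) 2 := by
  haveI := fact_irreducible_realPolyQ_of_not_sq (R := X ^ 2 + C 6 * X + C 7) rfl disc_not_sq_six_seven
  intro u hu
  have h3 : (3 : realField (X ^ 2 + C 6 * X + C 7)) ≠ 0 := by
    have h := (AdjoinRoot.of (realPolyQ (X ^ 2 + C 6 * X + C 7))).injective.ne (show (3 : ℚ) ≠ 0 by norm_num)
    rwa [map_ofNat, map_zero] at h
  rw [sqrtNegThreePlusSqrtTwo_mk_threeSubSqrtTwo_eq_mk_three rfl u (Units.mk0 3 h3) hu (Units.val_mk0 _)]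
  exact sqrtNegThreePlusSqrtTwo_three_nonsplit _ (Units.val_mk0 _)

end Summit.HodgeConjecture.HodgeConjecture.Ring2.WeilCoverageCM

end
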